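import Mathlib
import Literature.MathematicalPhysics.QuantumLattice.WilsonDiracAP

/-!
# Counting the `M⁴` block twists by the number of near-degenerate coordinates
(helper for crux stmt-QuantumFields-9734, line `Sketch`, stub `stub_twistCounting`)

What.  The `M⁴` Bloch blocks of the `2M`-torus carry twists `θ_k = (π k_μ / M + π / (2M))_{μ<4}`,
`k ∈ (Fin M)⁴`.  A coordinate is *small* when `min (θ, π - θ) < 1/2`, and `ns k` is the number of
small coordinates of `k`.  We prove that for `M ≥ 1000` the four regions satisfy
`#{ns = 0} ≥ M⁴/5`, `#{ns = 1} ≥ (39/100) M⁴`, `#{ns = 2} ≤ (3/10) M⁴`, `#{ns ≥ 3} ≤ (11/100) M⁴`.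

How.  Elementary counting, no physics.
* `TwistCounting.card_filter_pattern_eq` / `card_filter_card_eq`: for a predicate `q` on a finite
  type `α` with `b = #{q}`, `N = #α`, the maps `k : ι → α` with exactly `r` indices `i` satisfying
  `q (k i)` number `C(#ι, r) b^r (N - b)^{#ι - r}` (fibrewise over the pattern
  `{i | q (k i)} ∈ powersetCard r`, each fibre being the product set `Fintype.piFinset`).
* `TwistCounting.card_filter_twist_lt`: `θ_j < 1/2 ↔ j < ⌈M/(2π) - 1/2⌉₊`, so the one-sided count
  is within `[M/(2π) - 1/2, M/(2π) + 1/2)`; the other side is its mirror image under `Fin.rev`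
  (`θ_{rev j} = π - θ_j`) and the two sides are disjoint (`π > 1`), whence
  `b = #T ∈ [M/π - 1, M/π + 1)` (`card_twist_near`).
* `TwistCounting.region_bounds`: with `3.14 < π < 3.15` and `M ≥ 1000`,
  `0.316 M ≤ b ≤ 0.32 M`, and the four polynomial inequalities follow from monotone factor bounds
  (`0.68⁴ ≥ 1/5`, `4·0.316·0.68³ ≥ 39/100`, `6·0.32²·0.684² ≤ 3/10`,
  `4·0.32³·0.684 + 0.32⁴ ≤ 11/100`).
Sources: folklore; Mathlib only.  Pure theorem file.
-/

noncomputable section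

open scoped BigOperators Classical Matrix ComplexConjugate
open Finset
open Literature.MathematicalPhysics.QuantumLattice Literature.MathematicalPhysics.QuantumFieldTheory
  Literature.Probability.LatticeModels

namespace Summit.QuantumFields.QCD.Cruxes.CriticalLineDiamagnetism.ChessboardCellGain

namespace TwistCounting

/-! ### Product-set counting by pattern -/

/-- The maps `k : ι → α` whose set of indices `i` with `q (k i)` is exactly `Q` form the product
set `∏_i (if i ∈ Q then {q} else {¬ q})`, of cardinality `b ^ #Q * (N - b) ^ (#ι - #Q)`. -/
theorem card_filter_pattern_eq {ι α : Type*} [Fintype ι] [DecidableEq ι] [Fintype α]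
    (q : α → Prop) [DecidablePred q] (Q : Finset ι) :
    (univ.filter (fun k : ι → α => (univ.filter fun i => q (k i)) = Q)).card
      = (univ.filter q).card ^ Q.card
          * (Fintype.card α - (univ.filter q).card) ^ (Fintype.card ι - Q.card) := by
  classical
  have hset : (univ.filter (fun k : ι → α => (univ.filter fun i => q (k i)) = Q))
      = Fintype.piFinset (fun i => if i ∈ Q then univ.filter q else (univ.filter q)ᶜ) := by
    ext k
    simp only [mem_filter, mem_univ, true_and, Fintype.mem_piFinset]
    constructor
    · intro hk i
      rw [← hk]
      by_cases hi : q (k i)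
      · rw [if_pos (by simpa using hi)]
        simpa using hi
      · rw [if_neg (by simpa using hi)]
        simpa [mem_compl] using hi
    · intro hk
      ext i
      have hki := hk i
      simp only [mem_filter, mem_univ, true_and]
      by_cases hi : i ∈ Q
      · rw [if_pos hi] at hki
        simpa [hi] using hki
      · rw [if_neg hi, mem_compl, mem_filter] at hki
        simpa [hi] using hki
  rw [hset, Fintype.card_piFinset]
  simp_rw [apply_ite Finset.card]
  rw [prod_ite, prod_const, prod_const, filter_univ_mem, card_compl, filter_not, filter_univ_mem,
    card_univ_sdiff]

/-- The maps `k : ι → α` with exactly `r` indices `i` satisfying `q (k i)` number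
`C(#ι, r) * b ^ r * (N - b) ^ (#ι - r)`, `b = #{q}`, `N = #α`. -/
theorem card_filter_card_eq {ι α : Type*} [Fintype ι] [DecidableEq ι] [Fintype α]
    (q : α → Prop) [DecidablePred q] (r : ℕ) :
    (univ.filter (fun k : ι → α => (univ.filter fun i => q (k i)).card = r)).card
      = (Fintype.card ι).choose r * (univ.filter q).card ^ r
          * (Fintype.card α - (univ.filter q).card) ^ (Fintype.card ι - r) := by
  classical
  have hmaps : ((univ.filter (fun k : ι → α => (univ.filter fun i => q (k i)).card = r) :
      Finset (ι → α)) : Set (ι → α)).MapsTo (fun k : ι → α => univ.filter fun i => q (k i))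
        ((univ : Finset ι).powersetCard r) := by
    intro k hk
    rw [Finset.mem_coe, mem_filter] at hk
    rw [Finset.mem_coe, mem_powersetCard]
    exact ⟨subset_univ _, hk.2⟩
  rw [card_eq_sum_card_fiberwise hmaps]
  have hfib : ∀ Q ∈ (univ : Finset ι).powersetCard r,
      ((univ.filter (fun k : ι → α => (univ.filter fun i => q (k i)).card = r)).filter
          (fun k => (univ.filter fun i => q (k i)) = Q)).card
        = (univ.filter q).card ^ r
            * (Fintype.card α - (univ.filter q).card) ^ (Fintype.card ι - r) := by
    intro Q hQ
    have hQr : Q.card = r := (mem_powersetCard.1 hQ).2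
    rw [Finset.filter_filter]
    have heq : (univ.filter fun k : ι → α =>
          (univ.filter fun i => q (k i)).card = r ∧ (univ.filter fun i => q (k i)) = Q)
        = univ.filter fun k : ι → α => (univ.filter fun i => q (k i)) = Q := by
      apply Finset.filter_congr
      intro k _
      exact ⟨fun h => h.2, fun h => ⟨by rw [h, hQr], h⟩⟩
    rw [heq, card_filter_pattern_eq, hQr]
  rw [Finset.sum_congr rfl hfib, sum_const, card_powersetCard, card_univ, smul_eq_mul, mul_assoc]

/-- The four regions in dimension `4`: exact counts for `0, 1, 2` small coordinates and an upper
bound for `≥ 3`, in terms of `b = #{q}` and `N = #α`. -/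
theorem counts_four {α : Type*} [Fintype α] (q : α → Prop) [DecidablePred q] {b N : ℕ}
    (hb : (univ.filter q).card = b) (hN : Fintype.card α = N) :
    (univ.filter (fun k : Fin 4 → α => (univ.filter fun i => q (k i)).card = 0)).card
        = (N - b) ^ 4 ∧
    (univ.filter (fun k : Fin 4 → α => (univ.filter fun i => q (k i)).card = 1)).card
        = 4 * b * (N - b) ^ 3 ∧
    (univ.filter (fun k : Fin 4 → α => (univ.filter fun i => q (k i)).card = 2)).card
        = 6 * b ^ 2 * (N - b) ^ 2 ∧
    (univ.filter (fun k : Fin 4 → α => 3 ≤ (univ.filter fun i => q (k i)).card)).card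
        ≤ 4 * b ^ 3 * (N - b) + b ^ 4 := by
  have h := fun r => card_filter_card_eq (ι := Fin 4) q r
  simp only [Fintype.card_fin, hb, hN] at h
  have c2 : Nat.choose 4 2 = 6 := by decide
  have c3 : Nat.choose 4 3 = 4 := by decide
  refine ⟨?_, ?_, ?_, ?_⟩
  · rw [h 0]; simp
  · rw [h 1]; simp
  · rw [h 2, c2]
  · calc (univ.filter (fun k : Fin 4 → α => 3 ≤ (univ.filter fun i => q (k i)).card)).card
        ≤ (univ.filter (fun k : Fin 4 → α => (univ.filter fun i => q (k i)).card = 3) ∪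
            univ.filter (fun k : Fin 4 → α => (univ.filter fun i => q (k i)).card = 4)).card := by
          apply card_le_card
          intro k hk
          simp only [mem_filter, mem_univ, true_and, mem_union] at hk ⊢
          have : (univ.filter fun i => q (k i)).card ≤ 4 :=
            (card_filter_le _ _).trans (by simp)
          omega
      _ ≤ _ := card_union_le _ _
      _ = 4 * b ^ 3 * (N - b) + b ^ 4 := by rw [h 3, h 4, c3]; simp

/-! ### The one-dimensional count -/

/-- One-sided count: `#{j < M : π j / M + π/(2M) < 1/2}` lies in `[M/(2π) - 1/2, M/(2π) + 1/2)`. -/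
theorem card_filter_twist_lt (M : ℕ) (hM : 4 ≤ M) :
    (M : ℝ) / (2 * Real.pi) - 1 / 2
        ≤ ((univ.filter fun j : Fin M =>
            Real.pi * ((j : ℕ) : ℝ) / M + Real.pi / (2 * M) < 1 / 2).card : ℝ) ∧
    ((univ.filter fun j : Fin M =>
        Real.pi * ((j : ℕ) : ℝ) / M + Real.pi / (2 * M) < 1 / 2).card : ℝ)
        < (M : ℝ) / (2 * Real.pi) + 1 / 2 := by
  set c : ℝ := (M : ℝ) / (2 * Real.pi) - 1 / 2 with hc
  have hM' : (4 : ℝ) ≤ M := by exact_mod_cast hM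
  have hMpos : (0 : ℝ) < M := by linarith
  have hMne : (M : ℝ) ≠ 0 := hMpos.ne'
  have hπ3 := Real.pi_gt_three
  have hπ4 := Real.pi_lt_four
  have hπne : Real.pi ≠ 0 := Real.pi_ne_zero
  have hc0 : 0 ≤ c := by
    rw [hc, sub_nonneg, le_div_iff₀ (by positivity)]
    linarith
  have hcM : ⌈c⌉₊ ≤ M := by
    refine Nat.ceil_le.2 ?_
    have : (M : ℝ) / (2 * Real.pi) ≤ M := div_le_self hMpos.le (by linarith)
    rw [hc]
    linarith
  have key : ∀ x : ℝ, Real.pi * x / M + Real.pi / (2 * M) < 1 / 2 ↔ x < c := by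
    intro x
    have e : Real.pi * x / M + Real.pi / (2 * M) = 1 / 2 - Real.pi / M * (c - x) := by
      rw [hc]
      field_simp
      ring
    rw [e, sub_lt_self_iff, mul_pos_iff_of_pos_left (by positivity), sub_pos]
  have hset : (univ.filter fun j : Fin M =>
        Real.pi * ((j : ℕ) : ℝ) / M + Real.pi / (2 * M) < 1 / 2)
      = (range ⌈c⌉₊).attachFin (fun m hm => lt_of_lt_of_le (mem_range.1 hm) hcM) := by
    ext j
    simp only [mem_filter, mem_univ, true_and, mem_attachFin, mem_range, key, Nat.lt_ceil]
  rw [hset, card_attachFin, card_range]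
  exact ⟨Nat.le_ceil c, (Nat.ceil_lt_add_one hc0).trans_eq (by rw [hc]; ring)⟩

/-- Two-sided count: `b = #{j < M : min (θ_j, π - θ_j) < 1/2}` lies in `[M/π - 1, M/π + 1)`
(the two sides are mirror images under `Fin.rev` and disjoint). -/
theorem card_twist_near (M : ℕ) (hM : 4 ≤ M) :
    (M : ℝ) / Real.pi - 1
        ≤ ((univ.filter fun j : Fin M =>
            min (Real.pi * ((j : ℕ) : ℝ) / M + Real.pi / (2 * M))
              (Real.pi - (Real.pi * ((j : ℕ) : ℝ) / M + Real.pi / (2 * M))) < 1 / 2).card : ℝ) ∧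
    ((univ.filter fun j : Fin M =>
        min (Real.pi * ((j : ℕ) : ℝ) / M + Real.pi / (2 * M))
          (Real.pi - (Real.pi * ((j : ℕ) : ℝ) / M + Real.pi / (2 * M))) < 1 / 2).card : ℝ)
        < (M : ℝ) / Real.pi + 1 := by
  have hM0 : 0 < M := by omega
  have hMpos : (0 : ℝ) < M := by exact_mod_cast hM0
  have hMne : (M : ℝ) ≠ 0 := hMpos.ne'
  have hrev : ∀ j : Fin M, Real.pi * (((Fin.rev j : Fin M) : ℕ) : ℝ) / M + Real.pi / (2 * M)
      = Real.pi - (Real.pi * ((j : ℕ) : ℝ) / M + Real.pi / (2 * M)) := by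
    intro j
    have hj : (j : ℕ) + 1 ≤ M := j.isLt
    rw [Fin.val_rev, Nat.cast_sub hj, Nat.cast_add, Nat.cast_one]
    field_simp
    ring
  have hsplit : (univ.filter fun j : Fin M =>
        min (Real.pi * ((j : ℕ) : ℝ) / M + Real.pi / (2 * M))
          (Real.pi - (Real.pi * ((j : ℕ) : ℝ) / M + Real.pi / (2 * M))) < 1 / 2)
      = (univ.filter fun j : Fin M => Real.pi * ((j : ℕ) : ℝ) / M + Real.pi / (2 * M) < 1 / 2) ∪
        (univ.filter fun j : Fin M =>
          Real.pi - (Real.pi * ((j : ℕ) : ℝ) / M + Real.pi / (2 * M)) < 1 / 2) := by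
    ext j
    simp only [mem_filter, mem_univ, true_and, mem_union, min_lt_iff]
  have hdisj : Disjoint
      (univ.filter fun j : Fin M => Real.pi * ((j : ℕ) : ℝ) / M + Real.pi / (2 * M) < 1 / 2)
      (univ.filter fun j : Fin M =>
        Real.pi - (Real.pi * ((j : ℕ) : ℝ) / M + Real.pi / (2 * M)) < 1 / 2) := by
    rw [Finset.disjoint_filter]
    intro j _ h1 h2
    linarith [Real.pi_gt_three]
  have hsymm : (univ.filter fun j : Fin M =>
        Real.pi - (Real.pi * ((j : ℕ) : ℝ) / M + Real.pi / (2 * M)) < 1 / 2).card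
      = (univ.filter fun j : Fin M =>
          Real.pi * ((j : ℕ) : ℝ) / M + Real.pi / (2 * M) < 1 / 2).card := by
    refine Finset.card_equiv Fin.revPerm (fun j => ?_)
    simp only [mem_filter, mem_univ, true_and, Fin.revPerm_apply]
    rw [hrev]
  rw [hsplit, card_union_of_disjoint hdisj, hsymm, Nat.cast_add]
  obtain ⟨h1, h2⟩ := card_filter_twist_lt M hM
  have e : (M : ℝ) / (2 * Real.pi) = M / Real.pi / 2 := by ring
  constructor <;> linarith

/-! ### The polynomial inequalities -/

/-- For `m ≥ 1000` and `β ∈ [m/π - 1, m/π + 1]`: the four region bounds with constants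
`1/5, 39/100, 3/10, 11/100`. -/
theorem region_bounds (m β : ℝ) (hm : 1000 ≤ m) (hβ0 : 0 ≤ β) (hlo : m / Real.pi - 1 ≤ β)
    (hhi : β ≤ m / Real.pi + 1) :
    (1 / 5 : ℝ) * m ^ 4 ≤ (m - β) ^ 4 ∧ (39 / 100 : ℝ) * m ^ 4 ≤ 4 * β * (m - β) ^ 3 ∧
    6 * β ^ 2 * (m - β) ^ 2 ≤ (3 / 10 : ℝ) * m ^ 4 ∧
    4 * β ^ 3 * (m - β) + β ^ 4 ≤ (11 / 100 : ℝ) * m ^ 4 := by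
  have hπlo := Real.pi_gt_d2
  have hπhi := Real.pi_lt_d2
  have hm0 : 0 ≤ m := by linarith
  have h1 : m / Real.pi ≤ m / 3.14 := div_le_div_of_nonneg_left hm0 (by norm_num) hπlo.le
  have h2 : m / 3.15 ≤ m / Real.pi := div_le_div_of_nonneg_left hm0 Real.pi_pos hπhi.le
  have hbhi : β ≤ 0.32 * m := by
    have : m / 3.14 ≤ 0.32 * m - 1 := by
      rw [div_le_iff₀ (by norm_num)]
      linarith
    linarith
  have hblo : 0.316 * m ≤ β := by
    have : 0.316 * m + 1 ≤ m / 3.15 := by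
      rw [le_div_iff₀ (by norm_num)]
      linarith
    linarith
  have hdlo : 0.68 * m ≤ m - β := by linarith
  have hdhi : m - β ≤ 0.684 * m := by linarith
  have hd0 : 0 ≤ m - β := by linarith
  have hm4 : 0 ≤ m ^ 4 := pow_nonneg hm0 4
  refine ⟨?_, ?_, ?_, ?_⟩
  · calc (1 / 5 : ℝ) * m ^ 4 ≤ (0.68 * m) ^ 4 := by
          rw [mul_pow]
          exact mul_le_mul_of_nonneg_right (by norm_num) hm4
      _ ≤ (m - β) ^ 4 := pow_le_pow_left₀ (by positivity) hdlo 4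
  · calc (39 / 100 : ℝ) * m ^ 4 ≤ 4 * (0.316 * m) * (0.68 * m) ^ 3 := by
          rw [show 4 * (0.316 * m) * (0.68 * m) ^ 3 = (4 * 0.316 * 0.68 ^ 3) * m ^ 4 by ring]
          exact mul_le_mul_of_nonneg_right (by norm_num) hm4
      _ ≤ 4 * β * (m - β) ^ 3 :=
          mul_le_mul (mul_le_mul_of_nonneg_left hblo (by norm_num))
            (pow_le_pow_left₀ (by positivity) hdlo 3) (by positivity) (by positivity)
  · calc 6 * β ^ 2 * (m - β) ^ 2 ≤ 6 * (0.32 * m) ^ 2 * (0.684 * m) ^ 2 :=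
          mul_le_mul (mul_le_mul_of_nonneg_left (pow_le_pow_left₀ hβ0 hbhi 2) (by norm_num))
            (pow_le_pow_left₀ hd0 hdhi 2) (by positivity) (by positivity)
      _ ≤ (3 / 10 : ℝ) * m ^ 4 := by
          rw [show 6 * (0.32 * m) ^ 2 * (0.684 * m) ^ 2 = (6 * 0.32 ^ 2 * 0.684 ^ 2) * m ^ 4 by
            ring]
          exact mul_le_mul_of_nonneg_right (by norm_num) hm4
  · calc 4 * β ^ 3 * (m - β) + β ^ 4 ≤ 4 * (0.32 * m) ^ 3 * (0.684 * m) + (0.32 * m) ^ 4 :=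
          add_le_add (mul_le_mul (mul_le_mul_of_nonneg_left (pow_le_pow_left₀ hβ0 hbhi 3)
            (by norm_num)) hdhi hd0 (by positivity)) (pow_le_pow_left₀ hβ0 hbhi 4)
      _ ≤ (11 / 100 : ℝ) * m ^ 4 := by
          rw [show 4 * (0.32 * m) ^ 3 * (0.684 * m) + (0.32 * m) ^ 4
              = (4 * 0.32 ^ 3 * 0.684 + 0.32 ^ 4) * m ^ 4 by ring]
          exact mul_le_mul_of_nonneg_right (by norm_num) hm4

end TwistCounting

/-- **Stub MgN — `twistCounting` (elementary counting of block twists by region).**  For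
`M ≥ 1000`, with `ns k` the number of coordinates `μ < 4` of the twist
`θ_k = (π k_μ / M + π/(2M))_μ` within `1/2` of `{0, π}`:
`#{ns = 0} ≥ M⁴/5`, `#{ns = 1} ≥ (39/100) M⁴`, `#{ns = 2} ≤ (3/10) M⁴`, `#{ns ≥ 3} ≤ (11/100) M⁴`.
Proof: `#{ns = r} = C(4,r) b^r (M - b)^{4-r}` with `b ∈ [M/π - 1, M/π + 1)` the one-dimensional
count (`TwistCounting.counts_four`, `TwistCounting.card_twist_near`), and the polynomial
inequalities `TwistCounting.region_bounds`. -/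
theorem stub_twistCounting : ∃ M₁ : ℕ, ∀ (M : ℕ) [NeZero M], M₁ ≤ M → let ns : (Fin 4 → Fin M) → ℕ := fun k => (Finset.univ.filter (fun μ : Fin 4 => min (Real.pi * ((k μ : ℕ) : ℝ) / M + Real.pi / (2 * M)) (Real.pi - (Real.pi * ((k μ : ℕ) : ℝ) / M + Real.pi / (2 * M))) < 1 / 2)).card; (1 / 5 : ℝ) * (M : ℝ) ^ 4 ≤ ((Finset.univ.filter (fun k : Fin 4 → Fin M => ns k = 0)).card : ℝ) ∧ (39 / 100 : ℝ) * (M : ℝ) ^ 4 ≤ ((Finset.univ.filter (fun k : Fin 4 → Fin M => ns k = 1)).card : ℝ) ∧ ((Finset.univ.filter (fun k : Fin 4 → Fin M => ns k = 2)).card : ℝ) ≤ (3 / 10 : ℝ) * (M : ℝ) ^ 4 ∧ ((Finset.univ.filter (fun k : Fin 4 → Fin M => 3 ≤ ns k)).card : ℝ) ≤ (11 / 100 : ℝ) * (M : ℝ) ^ 4 := by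
  refine ⟨1000, ?_⟩
  intro M _ hM
  dsimp only
  have hM4 : 4 ≤ M := le_trans (by norm_num) hM
  obtain ⟨hlo, hhi⟩ := TwistCounting.card_twist_near M hM4
  set b : ℕ := (univ.filter fun j : Fin M =>
      min (Real.pi * ((j : ℕ) : ℝ) / M + Real.pi / (2 * M))
        (Real.pi - (Real.pi * ((j : ℕ) : ℝ) / M + Real.pi / (2 * M))) < 1 / 2).card with hb
  have hbM : b ≤ M := (card_filter_le _ _).trans (by simp)
  obtain ⟨c0, c1, c2, c3⟩ := TwistCounting.counts_four
    (fun j : Fin M => min (Real.pi * ((j : ℕ) : ℝ) / M + Real.pi / (2 * M))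
      (Real.pi - (Real.pi * ((j : ℕ) : ℝ) / M + Real.pi / (2 * M))) < 1 / 2) hb.symm
    (Fintype.card_fin M)
  obtain ⟨i1, i2, i3, i4⟩ := TwistCounting.region_bounds (M : ℝ) (b : ℝ) (by exact_mod_cast hM)
    (Nat.cast_nonneg b) hlo hhi.le
  refine ⟨?_, ?_, ?_, ?_⟩
  · rw [c0]
    push_cast [Nat.cast_sub hbM]
    exact i1
  · rw [c1]
    push_cast [Nat.cast_sub hbM]
    exact i2
  · rw [c2]
    push_cast [Nat.cast_sub hbM]
    exact i3
  · calc _ ≤ ((4 * b ^ 3 * (M - b) + b ^ 4 : ℕ) : ℝ) := by exact_mod_cast c3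
      _ = 4 * (b : ℝ) ^ 3 * ((M : ℝ) - b) + (b : ℝ) ^ 4 := by push_cast [Nat.cast_sub hbM]; ring
      _ ≤ _ := i4

end Summit.QuantumFields.QCD.Cruxes.CriticalLineDiamagnetism.ChessboardCellGain
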